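import Summits.CriticalPhenomena.PercolationContinuityZ3.Theorems.Transplant.FKConnectivityAllQPat3KNetPlaceReduce
import Summits.CriticalPhenomena.PercolationContinuityZ3.Theorems.Transplant.FKConnectivityAllQPat3EeeLeafKTriClaw
import Summits.CriticalPhenomena.PercolationContinuityZ3.Theorems.Transplant.FKConnectivityAllQPat3MinorInduction
import HarnessLib

/-!
# Connectivity correlation inequalities for `φ_{w,q}`, every `q > 0` — THEOREM SP(𝒦): the generic TRIANGLE placement lemma

Helper file (`--supports stmt-CriticalPhenomena-4575`), census lineage (gen 41) of LANE 2's FK sub-programme; builds on p205010 (kernel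
theorem, internal audit signed; external expert review pending).  No definitions, no named facts, no sorries; standard axioms.

`FK.placeK_tri`: on a `K₄` with six 𝒦-slots (`FK.K4Sep`, corners `a b c d`), marks `m₁ ∈ Qab°`, `m₂ ∈ Qbc°`, `m₃ ∈ Qca°` (the three
slots of the triangle `a b c`), every minor is SP-good at `(m₁, m₂, m₃)` — given the outer induction hypothesis.  The three mark-free
slots `ad, bd, cd` are reduced to plain edges in `E ∪ C` («Pat3KNetPlaceReduce» `K4Sep.reduce_cd` under relabelings), doubled away from
`E ∩ C` («Pat3KNetPlaceSteps»), and the K-state TRIANGLE leaf «Pat3EeeLeafKTriClaw» closes.  The specs `tri` (triangle `x y c`) and `tri3`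
(triangle `x c d`) of «…KNetSPLeavesI» are instances.
[cite: AyyerLinussonRavichandran2025, §7 (p. 22)]
-/

namespace Summit.CriticalPhenomena.PercolationContinuityZ3.Theorems

namespace FK

open scoped Classical

variable {V : Type*} [Fintype V] {N₀ : Finset (Sym2 V)} {Qab Qac Qad Qbc Qbd Qcd : Finset (Sym2 V)} {a b c d m₁ m₂ m₃ : V}

/-- The TRIANGLE placement once the three mark-free slots are plain edges in `E ∪ C`. [cite: AyyerLinussonRavichandran2025, §7 (p. 22)] -/
theorem placeK_tri_plain (h : K4Sep Qab Qac {s(a, d)} Qbc {s(b, d)} {s(c, d)} a b c d) (hab : IsKNet Qab a b)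
    (hac : IsKNet Qac a c) (had : a ≠ d) (hbc : IsKNet Qbc b c) (hbd : b ≠ d) (hcd : c ≠ d)
    (hm₁ : ∃ e ∈ Qab, m₁ ∈ e) (hm₁a : m₁ ≠ a) (hm₁b : m₁ ≠ b) (hm₂ : ∃ e ∈ Qbc, m₂ ∈ e) (hm₂b : m₂ ≠ b) (hm₂c : m₂ ≠ c)
    (hm₃ : ∃ e ∈ Qac, m₃ ∈ e) (hm₃a : m₃ ≠ a) (hm₃c : m₃ ≠ c)
    {E C : Finset (Sym2 V)} (hE : E ⊆ Qab ∪ (Qac ∪ {s(a, d)} ∪ Qbc ∪ {s(b, d)} ∪ {s(c, d)}))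
    (hC : C ⊆ Qab ∪ (Qac ∪ {s(a, d)} ∪ Qbc ∪ {s(b, d)} ∪ {s(c, d)}))
    (xad : s(a, d) ∈ E ∨ s(a, d) ∈ C) (xbd : s(b, d) ∈ E ∨ s(b, d) ∈ C) (xcd : s(c, d) ∈ E ∨ s(c, d) ∈ C) :
    SPGoodC E C m₁ m₂ m₃ := by
  -- distinctness
  have ha_bc : ¬ ∃ e ∈ Qbc, a ∈ e := fun hh => hab.ne (h.v_ab_bc a hab.left_mem hh)
  have hb_ac : ¬ ∃ e ∈ Qac, b ∈ e := fun hh => hab.ne (h.v_ab_ac b hab.right_mem hh).symm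
  have hc_ab : ¬ ∃ e ∈ Qab, c ∈ e := fun hh => hac.ne (h.v_ab_ac c hh hac.right_mem).symm
  have hd_ab : ¬ ∃ e ∈ Qab, d ∈ e := fun hh => had (h.v_ab_ad d hh ⟨_, Finset.mem_singleton_self _, Sym2.mem_mk_right _ _⟩).symm
  have hd_bc : ¬ ∃ e ∈ Qbc, d ∈ e := fun hh => hbd (h.v_bc_bd d hh ⟨_, Finset.mem_singleton_self _, Sym2.mem_mk_right _ _⟩).symm
  have hd_ac : ¬ ∃ e ∈ Qac, d ∈ e := fun hh => had (h.v_ac_ad d hh ⟨_, Finset.mem_singleton_self _, Sym2.mem_mk_right _ _⟩).symm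
  have n1_bc : ¬ ∃ e ∈ Qbc, m₁ ∈ e := fun hh => hm₁b (h.v_ab_bc m₁ hm₁ hh)
  have n1_ac : ¬ ∃ e ∈ Qac, m₁ ∈ e := fun hh => hm₁a (h.v_ab_ac m₁ hm₁ hh)
  have n2_ab : ¬ ∃ e ∈ Qab, m₂ ∈ e := fun hh => hm₂b (h.v_ab_bc m₂ hh hm₂)
  have n2_ac : ¬ ∃ e ∈ Qac, m₂ ∈ e := fun hh => hm₂c (h.v_ac_bc m₂ hh hm₂)
  have n3_ab : ¬ ∃ e ∈ Qab, m₃ ∈ e := fun hh => hm₃a (h.v_ab_ac m₃ hh hm₃)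
  have n3_bc : ¬ ∃ e ∈ Qbc, m₃ ∈ e := fun hh => hm₃c (h.v_ac_bc m₃ hm₃ hh)
  have d12 : m₁ ≠ m₂ := fun e => n1_bc (e ▸ hm₂)
  have d13 : m₁ ≠ m₃ := fun e => n1_ac (e ▸ hm₃)
  have d23 : m₂ ≠ m₃ := fun e => n2_ac (e ▸ hm₃)
  have ha2 : a ≠ m₂ := fun e => ha_bc (e ▸ hm₂)
  have hb3 : b ≠ m₃ := fun e => hb_ac (e ▸ hm₃)
  have hc1 : c ≠ m₁ := fun e => hc_ab (e ▸ hm₁)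
  have hd1 : d ≠ m₁ := fun e => hd_ab (e ▸ hm₁)
  have hd2 : d ≠ m₂ := fun e => hd_bc (e ▸ hm₂)
  have hd3 : d ≠ m₃ := fun e => hd_ac (e ▸ hm₃)
  -- plain edges
  set P3 : Finset (Sym2 V) := {s(a, d), s(b, d), s(c, d)} with hP3
  have nad_ab : s(a, d) ∉ Qab := Finset.disjoint_singleton_right.1 h.d_ab_ad
  have nad_ac : s(a, d) ∉ Qac := Finset.disjoint_singleton_right.1 h.d_ac_ad
  have nad_bc : s(a, d) ∉ Qbc := Finset.disjoint_singleton_left.1 h.d_ad_bc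
  have nbd_ab : s(b, d) ∉ Qab := Finset.disjoint_singleton_right.1 h.d_ab_bd
  have nbd_ac : s(b, d) ∉ Qac := Finset.disjoint_singleton_right.1 h.d_ac_bd
  have nbd_bc : s(b, d) ∉ Qbc := Finset.disjoint_singleton_right.1 h.d_bc_bd
  have ncd_ab : s(c, d) ∉ Qab := Finset.disjoint_singleton_right.1 h.d_ab_cd
  have ncd_ac : s(c, d) ∉ Qac := Finset.disjoint_singleton_right.1 h.d_ac_cd
  have ncd_bc : s(c, d) ∉ Qbc := Finset.disjoint_singleton_right.1 h.d_bc_cd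
  have hPEC : ∀ e ∈ P3, e ∈ E ∨ e ∈ C := by
    intro e he
    simp only [hP3, Finset.mem_insert, Finset.mem_singleton] at he
    rcases he with rfl | rfl | rfl
    exacts [xad, xbd, xcd]
  have hNP : ∀ e ∈ Qab ∪ (Qac ∪ {s(a, d)} ∪ Qbc ∪ {s(b, d)} ∪ {s(c, d)}), e ∉ Qab → e ∉ Qbc → e ∉ Qac → e ∈ P3 := by
    intro e he h1 h2 h3
    simp only [Finset.mem_union, Finset.mem_singleton] at he
    simp only [hP3, Finset.mem_insert, Finset.mem_singleton]
    rcases he with e' | (((e' | e') | e') | e') | e'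
    exacts [absurd e' h1, absurd e' h3, Or.inl e', absurd e' h2, Or.inr (Or.inl e'), Or.inr (Or.inr e')]
  have hPQ : ∀ e ∈ P3, e ∉ Qab ∧ e ∉ Qbc ∧ e ∉ Qac := by
    intro e he
    simp only [hP3, Finset.mem_insert, Finset.mem_singleton] at he
    rcases he with rfl | rfl | rfl
    exacts [⟨nad_ab, nad_bc, nad_ac⟩, ⟨nbd_ab, nbd_bc, nbd_ac⟩, ⟨ncd_ab, ncd_bc, ncd_ac⟩]
  -- doubling
  refine SPGoodC.of_sdiff (D := C ∩ P3) Finset.inter_subset_left ?_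
  set E' : Finset (Sym2 V) := E \ (C ∩ P3) with hE'
  have hE'E : E' ⊆ E := Finset.sdiff_subset
  -- the leaf
  set p : Fin 7 → V := ![a, b, c, d, m₁, m₂, m₃] with hp
  have hinj : Function.Injective p :=
    injective_vec7 hab.ne hac.ne had hm₁a.symm ha2 hm₃a.symm hbc.ne hbd hm₁b.symm hm₂b.symm hb3 hcd hc1 hm₂c.symm hm₃c.symm hd1 hd2
      hd3 d12 d13 d23
  have hPS : plainSet p ([(0, 3), (1, 3), (2, 3)] : List (Fin 7 × Fin 7)) = P3 := by
    ext e
    rw [mem_plainSet_iff]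
    simp only [List.mem_cons, List.not_mem_nil, or_false, hP3, Finset.mem_insert, Finset.mem_singleton, pedge]
    constructor
    · rintro ⟨e₀, he₀, rfl⟩
      rcases he₀ with rfl | rfl | rfl <;> simp [hp]
    · rintro (rfl | rfl | rfl)
      exacts [⟨(0, 3), Or.inl rfl, rfl⟩, ⟨(1, 3), Or.inr (Or.inl rfl), rfl⟩, ⟨(2, 3), Or.inr (Or.inr rfl), rfl⟩]
  have hLK : ((([(0, 3), (1, 3), (2, 3)] : List (Fin 7 × Fin 7)).filter fun e => decide (pedge p e ∈ E')),
      (([(0, 3), (1, 3), (2, 3)] : List (Fin 7 × Fin 7)).filter fun e => decide (pedge p e ∈ C))) ∈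
      splits ([(0, 3), (1, 3), (2, 3)] : List (Fin 7 × Fin 7)) := by
    refine filter_mem_splits _ _ _ fun e₀ he₀ => ?_
    have hP : pedge p e₀ ∈ P3 := by rw [← hPS]; exact (mem_plainSet_iff p _ _).2 ⟨e₀, he₀, rfl⟩
    by_cases hc : pedge p e₀ ∈ C
    · have hn : pedge p e₀ ∉ E' := fun h' => (Finset.mem_sdiff.1 h').2 (Finset.mem_inter.2 ⟨hc, hP⟩)
      simp [hc, hn]
    · have hy : pedge p e₀ ∈ E' := Finset.mem_sdiff.2 ⟨(hPEC _ hP).resolve_right hc, fun h' => hc (Finset.mem_inter.1 h').1⟩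
      simp [hc, hy]
  have hpK : ∀ j, p j ∈ {z : V | ∃ e ∈ Qab, z ∈ e} → p j = p 0 ∨ p j = p 1 ∨ p j = p 4 := by
    intro j hj
    fin_cases j
    · exact Or.inl rfl
    · exact Or.inr (Or.inl rfl)
    · exact absurd hj hc_ab
    · exact absurd hj hd_ab
    · exact Or.inr (Or.inr rfl)
    · exact absurd hj n2_ab
    · exact absurd hj n3_ab
  have hp1 : ∀ j, p j ∈ {z : V | ∃ e ∈ Qbc, z ∈ e} → p j = p 1 ∨ p j = p 2 ∨ p j = p 5 := by
    intro j hj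
    fin_cases j
    · exact absurd hj ha_bc
    · exact Or.inl rfl
    · exact Or.inr (Or.inl rfl)
    · exact absurd hj hd_bc
    · exact absurd hj n1_bc
    · exact Or.inr (Or.inr rfl)
    · exact absurd hj n3_bc
  have hp2 : ∀ j, p j ∈ {z : V | ∃ e ∈ Qac, z ∈ e} → p j = p 2 ∨ p j = p 0 ∨ p j = p 6 := by
    intro j hj
    fin_cases j
    · exact Or.inr (Or.inl rfl)
    · exact absurd hj hb_ac
    · exact Or.inl rfl
    · exact absurd hj hd_ac
    · exact absurd hj n1_ac
    · exact absurd hj n2_ac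
    · exact Or.inr (Or.inr rfl)
  have hK1 : ∀ z ∈ {z : V | ∃ e ∈ Qab, z ∈ e}, z ∈ {z : V | ∃ e ∈ Qbc, z ∈ e} → z = p 1 ∨ z = p 2 :=
    fun z h1 h2 => Or.inl (h.v_ab_bc z h1 h2)
  have hK2 : ∀ z ∈ {z : V | ∃ e ∈ Qab, z ∈ e}, z ∈ {z : V | ∃ e ∈ Qac, z ∈ e} → z = p 2 ∨ z = p 0 :=
    fun z h1 h2 => Or.inr (h.v_ab_ac z h1 h2)
  have h12 : ∀ z ∈ {z : V | ∃ e ∈ Qbc, z ∈ e}, z ∈ {z : V | ∃ e ∈ Qac, z ∈ e} → z = p 2 ∨ z = p 0 :=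
    fun z h1 h2 => Or.inl (h.v_ac_bc z h2 h1)
  have gK := span_sub_of_subset (fun e he z hz => (⟨e, Finset.mem_coe.1 he, hz⟩ : z ∈ {z : V | ∃ e ∈ Qab, z ∈ e}))
    (Finset.inter_subset_right (s₁ := E')) (Finset.inter_subset_right (s₁ := C))
  have g1 := span_sub_of_subset (fun e he z hz => (⟨e, Finset.mem_coe.1 he, hz⟩ : z ∈ {z : V | ∃ e ∈ Qbc, z ∈ e}))
    (Finset.inter_subset_right (s₁ := E')) (Finset.inter_subset_right (s₁ := C))
  have g2 := span_sub_of_subset (fun e he z hz => (⟨e, Finset.mem_coe.1 he, hz⟩ : z ∈ {z : V | ∃ e ∈ Qac, z ∈ e}))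
    (Finset.inter_subset_right (s₁ := E')) (Finset.inter_subset_right (s₁ := C))
  have hdK : Disjoint (plainSet p ([(0, 3), (1, 3), (2, 3)] : List (Fin 7 × Fin 7))) (E' ∩ Qab) := by
    rw [hPS]; exact Finset.disjoint_left.2 fun e he h' => (hPQ e he).1 (Finset.mem_inter.1 h').2
  have hd1 : Disjoint (plainSet p ([(0, 3), (1, 3), (2, 3)] : List (Fin 7 × Fin 7)) ∪ E' ∩ Qab) (E' ∩ Qbc) := by
    rw [hPS, Finset.disjoint_union_left]
    exact ⟨Finset.disjoint_left.2 fun e he h' => (hPQ e he).2.1 (Finset.mem_inter.1 h').2,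
      Finset.disjoint_of_subset_left Finset.inter_subset_right (Finset.disjoint_of_subset_right Finset.inter_subset_right h.d_ab_bc)⟩
  have hd2 : Disjoint (plainSet p ([(0, 3), (1, 3), (2, 3)] : List (Fin 7 × Fin 7)) ∪ E' ∩ Qab ∪ E' ∩ Qbc) (E' ∩ Qac) := by
    rw [hPS, Finset.disjoint_union_left, Finset.disjoint_union_left]
    exact ⟨⟨Finset.disjoint_left.2 fun e he h' => (hPQ e he).2.2 (Finset.mem_inter.1 h').2,
      Finset.disjoint_of_subset_left Finset.inter_subset_right (Finset.disjoint_of_subset_right Finset.inter_subset_right h.d_ab_ac)⟩,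
      Finset.disjoint_of_subset_left Finset.inter_subset_right (Finset.disjoint_of_subset_right Finset.inter_subset_right h.d_ac_bc.symm)⟩
  have hvalK : ∀ i ν, 0 ≤ lev2C (E' ∩ Qab) (C ∩ Qab) (p 0) (p 1) (p 4) (famGet famP11 i) ν := fun i ν =>
    famP11C_level_nonneg_of_isKNet hab Finset.inter_subset_right Finset.inter_subset_right hm₁ hm₁a hm₁b i ν
  have hval1 : ∀ i ν, 0 ≤ lev2C (E' ∩ Qbc) (C ∩ Qbc) (p 1) (p 2) (p 5) (famGet famP11 i) ν := fun i ν =>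
    famP11C_level_nonneg_of_isKNet hbc Finset.inter_subset_right Finset.inter_subset_right hm₂ hm₂b hm₂c i ν
  have hval2 : ∀ i ν, 0 ≤ lev2C (E' ∩ Qac) (C ∩ Qac) (p 2) (p 0) (p 6) (famGet famP11 i) ν := fun i ν =>
    famP11C_level_nonneg_of_isKNet hac.symm Finset.inter_subset_right Finset.inter_subset_right hm₃ hm₃c hm₃a i ν
  have hT := fun μ => eeeKTri_tsym_level_nonneg hinj hLK gK g1 g2 hpK hp1 hp2 hK1 hK2 h12 hm₁ hm₂ hm₃ hdK hd1 hd2 hvalK hval1 hval2 μ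
  have hX := fun μ => eeeKTri_starX_level_nonneg hinj hLK gK g1 g2 hpK hp1 hp2 hK1 hK2 h12 hm₁ hm₂ hm₃ hdK hd1 hd2 hvalK hval1 hval2 μ
  have hXm := fun μ =>
    eeeKTri_starXm_level_nonneg hinj hLK gK g1 g2 hpK hp1 hp2 hK1 hK2 h12 hm₁ hm₂ hm₃ hdK hd1 hd2 hvalK hval1 hval2 μ
  have hS := fun μ => eeeKTri_starS_level_nonneg hinj hLK gK g1 g2 hpK hp1 hp2 hK1 hK2 h12 hm₁ hm₂ hm₃ hdK hd1 hd2 hvalK hval1 hval2 μ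
  -- reading the leaf back on `(E', C)`
  have hE'N : E' ⊆ Qab ∪ (Qac ∪ {s(a, d)} ∪ Qbc ∪ {s(b, d)} ∪ {s(c, d)}) := hE'E.trans hE
  have read : ∀ {X : Finset (Sym2 V)}, X ⊆ Qab ∪ (Qac ∪ {s(a, d)} ∪ Qbc ∪ {s(b, d)} ∪ {s(c, d)}) →
      plainSet p (([(0, 3), (1, 3), (2, 3)] : List (Fin 7 × Fin 7)).filter fun e => decide (pedge p e ∈ X)) ∪ X ∩ Qab ∪ X ∩ Qbc ∪
        X ∩ Qac = X := by
    intro X hX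
    ext e
    rw [Finset.mem_union, Finset.mem_union, Finset.mem_union, mem_plainSet_filter, Finset.mem_inter, Finset.mem_inter, Finset.mem_inter]
    constructor
    · rintro (((⟨e₀, _, hf, rfl⟩ | ⟨h', _⟩) | ⟨h', _⟩) | ⟨h', _⟩)
      · exact of_decide_eq_true hf
      all_goals exact h'
    · intro h'
      by_cases hq1 : e ∈ Qab
      · exact Or.inl (Or.inl (Or.inr ⟨h', hq1⟩))
      by_cases hq2 : e ∈ Qbc
      · exact Or.inl (Or.inr ⟨h', hq2⟩)
      by_cases hq3 : e ∈ Qac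
      · exact Or.inr ⟨h', hq3⟩
      have hP : e ∈ plainSet p ([(0, 3), (1, 3), (2, 3)] : List (Fin 7 × Fin 7)) := by rw [hPS]; exact hNP e (hX h') hq1 hq2 hq3
      obtain ⟨e₀, he₀, rfl⟩ := (mem_plainSet_iff p _ e).1 hP
      exact Or.inl (Or.inl (Or.inl ⟨e₀, he₀, decide_eq_true h', rfl⟩))
  intro μ
  have h1 := hT μ; have h2 := hX μ; have h3 := hXm μ; have h4 := hS μ
  rw [read hE'N, read hC] at h1 h2 h3 h4
  exact ⟨h1, h2, h3, h4⟩

/-- **THE TRIANGLE PLACEMENT LEMMA ON A `K₄` WITH 𝒦-SLOTS** (census g41): marks inner in the three slots of the triangle `a b c`.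
[cite: AyyerLinussonRavichandran2025, §7 (p. 22)] -/
theorem placeK_tri
    (ihSP : ∀ {N' E' C' : Finset (Sym2 V)} {x' y' b' s' t' : V}, N'.card < N₀.card → IsKNet N' x' y' → E' ⊆ N' → C' ⊆ N' →
      (∃ e ∈ N', b' ∈ e) → (∃ e ∈ N', s' ∈ e) → (∃ e ∈ N', t' ∈ e) → b' ≠ s' → b' ≠ t' → s' ≠ t' → SPGoodC E' C' b' s' t')
    (h : K4Sep Qab Qac Qad Qbc Qbd Qcd a b c d) (hab : IsKNet Qab a b) (hac : IsKNet Qac a c) (had : IsKNet Qad a d)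
    (hbc : IsKNet Qbc b c) (hbd : IsKNet Qbd b d) (hcd : IsKNet Qcd c d)
    (hN : Qab ∪ (Qac ∪ Qad ∪ Qbc ∪ Qbd ∪ Qcd) ⊆ N₀)
    (hm₁ : ∃ e ∈ Qab, m₁ ∈ e) (hm₁a : m₁ ≠ a) (hm₁b : m₁ ≠ b) (hm₂ : ∃ e ∈ Qbc, m₂ ∈ e) (hm₂b : m₂ ≠ b) (hm₂c : m₂ ≠ c)
    (hm₃ : ∃ e ∈ Qac, m₃ ∈ e) (hm₃a : m₃ ≠ a) (hm₃c : m₃ ≠ c)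
    {E C : Finset (Sym2 V)} (hE : E ⊆ Qab ∪ (Qac ∪ Qad ∪ Qbc ∪ Qbd ∪ Qcd)) (hC : C ⊆ Qab ∪ (Qac ∪ Qad ∪ Qbc ∪ Qbd ∪ Qcd)) :
    SPGoodC E C m₁ m₂ m₃ := by
  have d12 : m₁ ≠ m₂ := fun e => hm₁b (h.v_ab_bc m₁ hm₁ (e ▸ hm₂))
  have d13 : m₁ ≠ m₃ := fun e => hm₁a (h.v_ab_ac m₁ hm₁ (e ▸ hm₃))
  have d23 : m₂ ≠ m₃ := fun e => hm₂c (h.v_ac_bc m₂ (e ▸ hm₃) hm₂)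
  -- memberships in a five-slot union, stated generally
  have m5 : ∀ {m : V} {Q A B C' D : Finset (Sym2 V)}, (∃ e ∈ Q, m ∈ e) → (Q = A ∨ Q = B ∨ Q = C' ∨ Q = D) → ∀ X : Finset (Sym2 V),
      ∃ e ∈ X ∪ (A ∪ B ∪ C' ∪ D), m ∈ e := by
    rintro m Q A B C' D ⟨e, he, hme⟩ hQ X
    refine ⟨e, ?_, hme⟩
    simp only [Finset.mem_union]
    rcases hQ with rfl | rfl | rfl | rfl
    exacts [Or.inr (Or.inl (Or.inl (Or.inl he))), Or.inr (Or.inl (Or.inl (Or.inr he))), Or.inr (Or.inl (Or.inr he)), Or.inr (Or.inr he)]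
  have mQab : ∀ {m : V} {Q A B C' D : Finset (Sym2 V)}, (∃ e ∈ Q, m ∈ e) → ∃ e ∈ Q ∪ (A ∪ B ∪ C' ∪ D), m ∈ e := by
    rintro m Q A B C' D ⟨e, he, hme⟩; exact ⟨e, Finset.mem_union_left _ he, hme⟩
  -- reduce `cd`
  refine K4Sep.reduce_cd ihSP h hab hac had hbc hbd hcd hN (mQab hm₁) (m5 hm₂ (Or.inr (Or.inr (Or.inl rfl))) _)
    (m5 hm₃ (Or.inl rfl) _) (fun hh => (h.v_ab_cd m₁ hm₁ hh).elim) (fun hh => absurd (h.v_bc_cd m₂ hm₂ hh) hm₂c)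
    (fun hh => absurd (h.v_ac_cd m₃ hm₃ hh) hm₃c) d12 d13 d23 hE hC fun hQcd xcd => ?_
  subst hQcd
  -- reduce `bd` (relabel `b ↔ c`: the slot `bd` becomes `cd`)
  have eN1 : Qab ∪ (Qac ∪ Qad ∪ Qbc ∪ Qbd ∪ {s(c, d)}) = Qac ∪ (Qab ∪ Qad ∪ Qbc ∪ {s(c, d)} ∪ Qbd) := by ac_rfl
  rw [eN1] at hN hE hC
  refine K4Sep.reduce_cd ihSP h.swap_bc hac hab had hbc.symm (IsKNet.edge hcd.ne) hbd hN (m5 hm₁ (Or.inl rfl) _)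
    (m5 hm₂ (Or.inr (Or.inr (Or.inl rfl))) _) (mQab hm₃) (fun hh => absurd (h.v_ab_bd m₁ hm₁ hh) hm₁b)
    (fun hh => absurd (h.v_bc_bd m₂ hm₂ hh) hm₂b) (fun hh => (h.v_ac_bd m₃ hm₃ hh).elim) d12 d13 d23 hE hC fun hQbd xbd => ?_
  subst hQbd
  -- reduce `ad` (relabel to `(b, c, a, d)`: the slot `ad` becomes `cd`)
  have eN2 : Qac ∪ (Qab ∪ Qad ∪ Qbc ∪ {s(c, d)} ∪ {s(b, d)}) = Qbc ∪ (Qab ∪ {s(b, d)} ∪ Qac ∪ {s(c, d)} ∪ Qad) := by ac_rfl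
  rw [eN2] at hN hE hC
  refine K4Sep.reduce_cd ihSP h.swap_ab.swap_bc hbc hab.symm (IsKNet.edge hbd.ne) hac.symm (IsKNet.edge hcd.ne) had hN
    (m5 hm₁ (Or.inl rfl) _) (mQab hm₂) (m5 hm₃ (Or.inr (Or.inr (Or.inl rfl))) _) (fun hh => absurd (h.v_ab_ad m₁ hm₁ hh) hm₁a)
    (fun hh => (h.v_ad_bc m₂ hh hm₂).elim) (fun hh => absurd (h.v_ac_ad m₃ hm₃ hh) hm₃a) d12 d13 d23 hE hC fun hQad xad => ?_
  subst hQad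
  have eN3 : Qbc ∪ (Qab ∪ {s(b, d)} ∪ Qac ∪ {s(c, d)} ∪ {s(a, d)}) = Qab ∪ (Qac ∪ {s(a, d)} ∪ Qbc ∪ {s(b, d)} ∪ {s(c, d)}) := by
    ac_rfl
  rw [eN3] at hE hC
  exact placeK_tri_plain h hab hac had.ne hbc hbd.ne hcd.ne hm₁ hm₁a hm₁b hm₂ hm₂b hm₂c hm₃ hm₃a hm₃c hE hC xad xbd xcd

end FK

end Summit.CriticalPhenomena.PercolationContinuityZ3.Theorems
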